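import Summits.ResolutionOfSingularities.ResolutionOfSingularities.Theorems.FrobeniusLadderFInjectiveMacaulayficationDimSlice
import HarnessLib

/-!
# THE DIM-`d` SLICE OVER AN ABSTRACT CM-CENTRE SUPPLIER (crux `FInjectiveMacaulayfication` stmt-ResolutionOfSingularities-15315, chain w45a; companion of
# `DimSlice` (p602937) making the Česnavičius input pluggable in either reading (A)/(B) or BY NAME — consumed by `DimSliceOfCesnavicius`; seat res-L1-w45a-stub-3 g8)

[OURS · L1 W4.5a] Support file (`--supports stmt-ResolutionOfSingularities-15315 --as helper`); replaces the role of NO printed item; NOT a statement of any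
manuscript; def-free. The proofs of `DimSlice` §2–§3 VERBATIM with the Česnavičius binder `hM` replaced by an abstract CM-CENTRE SUPPLIER `hCM` = the common
OUTPUT shape of `LocalMacaulayficationOfFact.exists_cmCentre_of_fact` (reading (A)) and `LocalMacaulayficationOfFactOffClosed.exists_cmCentre_of_factOffClosed`
(reading (B), door v37's named fact): at every point `x` of positive local dimension of an integral variety, every fibre-regular local blow-up
`S′ → Spec 𝒪_{X,x}` along `I ≠ ⊥` has a fibre-supported `𝓚 ≠ ⊥` all of whose blowings up have domain Cohen–Macaulay stalks. CONDITIONAL on {CP 1.1, 081R,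
CP 4.4} BY NAME, on `hCM`, on the CANDIDATE rungs `ClosedPointLocalResolutionAdmTr p e r` (levels `4 … d − 1`, `r ≥ 1`) and on the CANDIDATE F-half per level.
AI-written (AI review is weaker than expert review).

* `exists_isBlowup_full_of_cm_of_rungs_of_F` · `fiModel_integral_dimLe_of_cm_of_rungs_of_F` · `exists_fiModel_dimLe_of_cm_of_rungs_of_F` ·
  ★ `fInjectiveMacaulayfication_dimLe_of_cm_of_rungs_of_F (d) (hG h081R hP) (hCM) (hR) (hF) : «crux ∀-text + dim X ≤ d»` · `…_of_LFadmF`.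

[folklore assembly; cite: Temkin2008, Prop. 2.3.4; CossartPiltant2019, Thm. 1.1 (i)(ii) and Prop. 4.4; Cesnavicius2021, Thm. 5.3]
-/

-- single-problem summit: the doubled namespace component is forced
set_option linter.dupNamespace false

noncomputable section

namespace Summit.ResolutionOfSingularities.ResolutionOfSingularities.Theorems.FInjectiveMacaulayfication.DimSliceCM

open CategoryTheory CategoryTheory.Limits AlgebraicGeometry TopologicalSpace IsLocalRing
open Literature.AlgebraicGeometry.Resolution
open Summit.ResolutionOfSingularities.ResolutionOfSingularities.Theorems.FInjectiveMacaulayfication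
open SliceableCentre ClosedPointLocalResolutionAdm ClosedPointLocalResolutionAdmTr DimSlice

/-! ## §1 The slice over an abstract CM-centre supplier (the common output shape of the (A)- and (B)-readings of Česnavičius 5.3) -/

/-- **A FULL blow-up model of every integral separated finite-type `n`-FOLD, `n ≥ 4`**, modulo {CP 1.1, 081R, CP 4.4} ∧ an abstract CM-CENTRE SUPPLIER `hCM` ∧
the closed-point rungs `4 … n − 1` ∧ the F-half AT LEVEL `n`. §1 supplies a model regular off finitely many closed points; the dimension-free F-Temkin engine
(`FTemkinClosedPointsAdm.full_model_of_regularOffFinite_of_localAdm`) finishes at the closed singular points with the pointwise CM/F split.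
[OURS · conditional-result] [cite: Temkin2008, Prop. 2.3.4] [cite: CossartPiltant2019, Thm. 1.1; Prop. 4.4] [cite: Cesnavicius2021, Thm. 5.3] -/
theorem exists_isBlowup_full_of_cm_of_rungs_of_F
    (hG : CossartPiltant2019General.{0}) (h081R : Stacks081R.{0}) (hP : CossartPiltant2019Principalization.{0})
    (hCM : ∀ (p : ℕ), p.Prime → ∀ {k : Type} [Field k] [CharP k p] {X : Scheme.{0}} (f : X ⟶ Spec (.of k))
      [LocallyOfFiniteType f] [IsIntegral X] (x : X), ringKrullDim (X.presheaf.stalk x) ≠ 0 →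
      ∀ (S' : Scheme.{0}) (g : S' ⟶ Spec (X.presheaf.stalk x)) (I : (Spec (X.presheaf.stalk x)).IdealSheafData),
        I ≠ ⊥ → IsBlowup g I → (∀ s : S', g.base s ≠ closedPoint (X.presheaf.stalk x) → s ∈ Scheme.regularLocus S') →
        ∃ 𝓚 : S'.IdealSheafData, 𝓚 ≠ ⊥ ∧ (∀ s ∈ (𝓚.support : Set S'), g.base s = closedPoint (X.presheaf.stalk x)) ∧
          ∀ (S'' : Scheme.{0}) (π : S'' ⟶ S'), IsBlowup π 𝓚 → ∀ s : S'', IsDomain (S''.presheaf.stalk s) ∧ CMCl (S''.presheaf.stalk s))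
    {n : ℕ} (h4 : 4 ≤ n) (p : ℕ) (hp : p.Prime)
    (hR : ∀ e r : ℕ, 4 ≤ e → e + 1 ≤ n → 1 ≤ r → ClosedPointLocalResolutionAdmTr p e r)
    (hFn : ∀ (k : Type) [Field k] [CharP k p]
    (X : Scheme.{0}) (f : X ⟶ Spec (.of k)),
      IsSeparated f → LocallyOfFiniteType f → QuasiCompact f → IsIntegral X →
      ∀ x : X, IsClosed ({x} : Set X) → x ∉ Scheme.regularLocus X → ringKrullDim (X.presheaf.stalk x) = n →
      ∀ (S' : Scheme.{0}) (g : S' ⟶ Spec (X.presheaf.stalk x)) (I : (Spec (X.presheaf.stalk x)).IdealSheafData),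
        I ≠ ⊥ → (I.support : Set (Spec (X.presheaf.stalk x))) ⊆ (Scheme.regularLocus (Spec (X.presheaf.stalk x)))ᶜ → IsBlowup g I →
        (∀ s : S', g.base s ≠ closedPoint (X.presheaf.stalk x) → s ∈ Scheme.regularLocus S') →
        (∀ s : S', CMCl (S'.presheaf.stalk s)) →
        ∃ 𝓚 : S'.IdealSheafData, 𝓚 ≠ ⊥ ∧ (∀ s ∈ (𝓚.support : Set S'), g.base s = closedPoint (X.presheaf.stalk x)) ∧
          ∀ (S'' : Scheme.{0}) (π : S'' ⟶ S'), IsBlowup π 𝓚 →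
            ∀ s : S'', FullCl p (S''.presheaf.stalk s))
    (k : Type) [Field k] [CharP k p] (X : Scheme.{0}) (f₀ : X ⟶ Spec (.of k))
    [IsSeparated f₀] [LocallyOfFiniteType f₀] [QuasiCompact f₀] [IsIntegral X] (hn : topologicalKrullDim X = n) :
    ∃ (X'' : Scheme.{0}) (f'' : X'' ⟶ X) (J'' : X.IdealSheafData), IsBlowup f'' J'' ∧ J'' ≠ ⊥ ∧
      (J''.support : Set X) ⊆ (Scheme.regularLocus X)ᶜ ∧ ∀ x'' : X'', FullCl p (X''.presheaf.stalk x'') := by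
  classical
  obtain ⟨X', f, J, F, hf, hJ, -, hF, hFcl, hreg⟩ := regularOffFinite_of_rungs hG h081R hP p k X f₀ hn (by omega) hR
  refine FTemkinClosedPointsAdm.full_model_of_regularOffFinite_of_localAdm p hp k X f₀ ?_ X' f J hf hJ hF.toFinset
    (fun b hb => hFcl b (hF.mem_toFinset.mp hb)) (fun x' hx' => (Scheme.mem_regularLocus _).mp (hreg x' fun h => hx' (hF.mem_toFinset.mpr h)))
  intro b hbcl hbs S' g I hI hIadm hg hregS
  have hbn : ringKrullDim (X.presheaf.stalk b) = n := FTemkinClosedPoints.ringKrullDim_stalk_eq_of_isClosed f₀ hn b hbcl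
  exact FInjectiveMacaulayficationDimFourSlice.exists_fullCentre_of_cmHalf_of_fHalf_at p f₀ b hbs
    (fun S' g I hI hg hregS => hCM p hp f₀ b (by rw [hbn]; exact_mod_cast (show n ≠ 0 by omega)) S' g I hI hg hregS)
    (fun S' g I hI hIadm hg hregS hcm =>
      hFn k X f₀ inferInstance inferInstance inferInstance inferInstance b hbcl hbs hbn S' g I hI hIadm hg hregS hcm)
    S' g I hI hIadm hg hregS


/-- **Integral form, dimension ≤ d**: a proper birational integral model FULL at every point (dimension ≤ 3: Cossart–Piltant outright; dimension
`n ∈ [4, d]`: §2 with the rungs `4 … n − 1` and the F-half at level `n`). [OURS · conditional-result]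
[cite: CossartPiltant2019, Thm. 1.1; Prop. 4.4] [cite: Temkin2008, Prop. 2.3.4] [cite: Cesnavicius2021, Thm. 5.3] -/
theorem fiModel_integral_dimLe_of_cm_of_rungs_of_F (d : ℕ)
    (hG : CossartPiltant2019General.{0}) (h081R : Stacks081R.{0}) (hP : CossartPiltant2019Principalization.{0})
    (hCM : ∀ (p : ℕ), p.Prime → ∀ {k : Type} [Field k] [CharP k p] {X : Scheme.{0}} (f : X ⟶ Spec (.of k))
      [LocallyOfFiniteType f] [IsIntegral X] (x : X), ringKrullDim (X.presheaf.stalk x) ≠ 0 →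
      ∀ (S' : Scheme.{0}) (g : S' ⟶ Spec (X.presheaf.stalk x)) (I : (Spec (X.presheaf.stalk x)).IdealSheafData),
        I ≠ ⊥ → IsBlowup g I → (∀ s : S', g.base s ≠ closedPoint (X.presheaf.stalk x) → s ∈ Scheme.regularLocus S') →
        ∃ 𝓚 : S'.IdealSheafData, 𝓚 ≠ ⊥ ∧ (∀ s ∈ (𝓚.support : Set S'), g.base s = closedPoint (X.presheaf.stalk x)) ∧
          ∀ (S'' : Scheme.{0}) (π : S'' ⟶ S'), IsBlowup π 𝓚 → ∀ s : S'', IsDomain (S''.presheaf.stalk s) ∧ CMCl (S''.presheaf.stalk s))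
    (p : ℕ) [hp : Fact p.Prime]
    (hR : ∀ e r : ℕ, 4 ≤ e → e + 1 ≤ d → 1 ≤ r → ClosedPointLocalResolutionAdmTr p e r)
    (hF : ∀ n : ℕ, 4 ≤ n → n ≤ d → ∀ (k : Type) [Field k] [CharP k p]
    (X : Scheme.{0}) (f : X ⟶ Spec (.of k)),
      IsSeparated f → LocallyOfFiniteType f → QuasiCompact f → IsIntegral X →
      ∀ x : X, IsClosed ({x} : Set X) → x ∉ Scheme.regularLocus X → ringKrullDim (X.presheaf.stalk x) = n →
      ∀ (S' : Scheme.{0}) (g : S' ⟶ Spec (X.presheaf.stalk x)) (I : (Spec (X.presheaf.stalk x)).IdealSheafData),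
        I ≠ ⊥ → (I.support : Set (Spec (X.presheaf.stalk x))) ⊆ (Scheme.regularLocus (Spec (X.presheaf.stalk x)))ᶜ → IsBlowup g I →
        (∀ s : S', g.base s ≠ closedPoint (X.presheaf.stalk x) → s ∈ Scheme.regularLocus S') →
        (∀ s : S', CMCl (S'.presheaf.stalk s)) →
        ∃ 𝓚 : S'.IdealSheafData, 𝓚 ≠ ⊥ ∧ (∀ s ∈ (𝓚.support : Set S'), g.base s = closedPoint (X.presheaf.stalk x)) ∧
          ∀ (S'' : Scheme.{0}) (π : S'' ⟶ S'), IsBlowup π 𝓚 →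
            ∀ s : S'', FullCl p (S''.presheaf.stalk s))
    (k : Type) [Field k] [CharP k p] (X : Scheme.{0}) (f : X ⟶ Spec (.of k))
    [IsSeparated f] [LocallyOfFiniteType f] [QuasiCompact f] [IsIntegral X] (hXd : topologicalKrullDim X ≤ d) :
    ∃ (X' : Scheme.{0}) (π : X' ⟶ X), IsProper π ∧ IsBirational π ∧ IsIntegral X' ∧ ∀ x : X', FullCl p (X'.presheaf.stalk x) := by
  by_cases h3 : topologicalKrullDim X ≤ 3
  · exact FInjectiveMacaulayficationDimFour.fiModel_integral_of_dim_le_three hG p k X f h3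
  · -- `dim X = n` with `4 ≤ n ≤ d`
    obtain ⟨n, h4n, hnd, hn⟩ : ∃ n : ℕ, 4 ≤ n ∧ n ≤ d ∧ topologicalKrullDim X = n := by
      have h := hXd
      induction hD : topologicalKrullDim X using WithBot.recBotCoe with
      | bot => rw [hD] at h3; exact absurd bot_le h3
      | coe a =>
        rw [hD] at h h3
        induction a using ENat.recTopCoe with
        | top => exact absurd (WithBot.coe_le_coe.mp h) (by simp)
        | coe m =>
          have hm : m ≤ d := by exact_mod_cast (WithBot.coe_le_coe.mp h)
          have hm' : ¬ m ≤ 3 := fun hle =>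
            h3 (WithBot.coe_le_coe.mpr (by exact_mod_cast hle : (m : ℕ∞) ≤ (3 : ℕ∞)))
          exact ⟨m, by omega, hm, rfl⟩
    haveI : IsLocallyNoetherian X := LocallyOfFiniteType.isLocallyNoetherian f
    obtain ⟨X'', f'', J'', hf'', hJ'', -, hfull⟩ := exists_isBlowup_full_of_cm_of_rungs_of_F hG h081R hP hCM h4n p hp.out
      (fun e r he hen hr => hR e r he (by omega) hr) (hF n h4n hnd) k X f hn
    haveI : IsIntegral X'' := hf''.isIntegral hJ''
    exact ⟨X'', f'', hf''.isProper, hf''.isBirational' hJ'', inferInstance, hfull⟩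

/-- **The crux's conclusion for a given reduced `X` of dimension ≤ d** (component gluing as in `DimLe4Reduced`). [OURS · conditional-result]
[cite: CossartPiltant2019, Thm. 1.1; Prop. 4.4; proof of Prop. 4.6 Step 1] [cite: Cesnavicius2021, Thm. 5.3] -/
theorem exists_fiModel_dimLe_of_cm_of_rungs_of_F (d : ℕ)
    (hG : CossartPiltant2019General.{0}) (h081R : Stacks081R.{0}) (hP : CossartPiltant2019Principalization.{0})
    (hCM : ∀ (p : ℕ), p.Prime → ∀ {k : Type} [Field k] [CharP k p] {X : Scheme.{0}} (f : X ⟶ Spec (.of k))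
      [LocallyOfFiniteType f] [IsIntegral X] (x : X), ringKrullDim (X.presheaf.stalk x) ≠ 0 →
      ∀ (S' : Scheme.{0}) (g : S' ⟶ Spec (X.presheaf.stalk x)) (I : (Spec (X.presheaf.stalk x)).IdealSheafData),
        I ≠ ⊥ → IsBlowup g I → (∀ s : S', g.base s ≠ closedPoint (X.presheaf.stalk x) → s ∈ Scheme.regularLocus S') →
        ∃ 𝓚 : S'.IdealSheafData, 𝓚 ≠ ⊥ ∧ (∀ s ∈ (𝓚.support : Set S'), g.base s = closedPoint (X.presheaf.stalk x)) ∧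
          ∀ (S'' : Scheme.{0}) (π : S'' ⟶ S'), IsBlowup π 𝓚 → ∀ s : S'', IsDomain (S''.presheaf.stalk s) ∧ CMCl (S''.presheaf.stalk s))
    (p : ℕ) [Fact p.Prime]
    (hR : ∀ e r : ℕ, 4 ≤ e → e + 1 ≤ d → 1 ≤ r → ClosedPointLocalResolutionAdmTr p e r)
    (hF : ∀ n : ℕ, 4 ≤ n → n ≤ d → ∀ (k : Type) [Field k] [CharP k p]
    (X : Scheme.{0}) (f : X ⟶ Spec (.of k)),
      IsSeparated f → LocallyOfFiniteType f → QuasiCompact f → IsIntegral X →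
      ∀ x : X, IsClosed ({x} : Set X) → x ∉ Scheme.regularLocus X → ringKrullDim (X.presheaf.stalk x) = n →
      ∀ (S' : Scheme.{0}) (g : S' ⟶ Spec (X.presheaf.stalk x)) (I : (Spec (X.presheaf.stalk x)).IdealSheafData),
        I ≠ ⊥ → (I.support : Set (Spec (X.presheaf.stalk x))) ⊆ (Scheme.regularLocus (Spec (X.presheaf.stalk x)))ᶜ → IsBlowup g I →
        (∀ s : S', g.base s ≠ closedPoint (X.presheaf.stalk x) → s ∈ Scheme.regularLocus S') →
        (∀ s : S', CMCl (S'.presheaf.stalk s)) →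
        ∃ 𝓚 : S'.IdealSheafData, 𝓚 ≠ ⊥ ∧ (∀ s ∈ (𝓚.support : Set S'), g.base s = closedPoint (X.presheaf.stalk x)) ∧
          ∀ (S'' : Scheme.{0}) (π : S'' ⟶ S'), IsBlowup π 𝓚 →
            ∀ s : S'', FullCl p (S''.presheaf.stalk s))
    (k : Type) [Field k] [CharP k p] (X : Scheme.{0}) (f : X ⟶ Spec (.of k))
    [IsSeparated f] [LocallyOfFiniteType f] [QuasiCompact f] [IsReduced X] (hXd : topologicalKrullDim X ≤ d) :
    ∃ (X' : Scheme.{0}) (π : X' ⟶ X), IsProper π ∧ IsBirational π ∧ ∀ x : X',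
      IsDomain (X'.presheaf.stalk x) ∧ ∀ d : ℕ, ringKrullDim (X'.presheaf.stalk x) = d →
        ∀ s : Fin d → X'.presheaf.stalk x, (Ideal.span (Set.range s)).radical.IsMaximal →
          RingTheory.Sequence.IsWeaklyRegular (X'.presheaf.stalk x) (List.ofFn s) ∧
          ∀ y : X'.presheaf.stalk x, (∃ e : ℕ, y ^ p ^ e ∈ Ideal.span
            ((fun z : X'.presheaf.stalk x => z ^ p ^ e) ''
              (Ideal.span (Set.range s) : Set (X'.presheaf.stalk x)))) →
            y ∈ Ideal.span (Set.range s) := by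
  refine exists_model_of_forall_closeds
    (fun Y : Scheme.{0} => ∀ y : Y, IsDomain (Y.presheaf.stalk y) ∧
      ∀ d : ℕ, ringKrullDim (Y.presheaf.stalk y) = d →
        ∀ s : Fin d → Y.presheaf.stalk y, (Ideal.span (Set.range s)).radical.IsMaximal →
          RingTheory.Sequence.IsWeaklyRegular (Y.presheaf.stalk y) (List.ofFn s) ∧
          ∀ w : Y.presheaf.stalk y, (∃ e : ℕ, w ^ p ^ e ∈ Ideal.span
            ((fun z : Y.presheaf.stalk y => z ^ p ^ e) ''
              (Ideal.span (Set.range s) : Set (Y.presheaf.stalk y)))) →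
            w ∈ Ideal.span (Set.range s))
    (fun Y hY y => (hY.false y).elim) (fun U V hU hV => fiClause_coprod p hU hV) X f fun Z hZ => ?_
  haveI := hZ
  have hdimZ : topologicalKrullDim (Scheme.IdealSheafData.vanishingIdeal Z).subscheme ≤ d :=
    (DimLe4Reduced.topologicalKrullDim_subscheme_vanishingIdeal_le Z).trans hXd
  obtain ⟨X', π, hprop, hbir, -, hfi⟩ :=
    fiModel_integral_dimLe_of_cm_of_rungs_of_F d hG h081R hP hCM p hR hF k _ ((Scheme.IdealSheafData.vanishingIdeal Z).subschemeι ≫ f) hdimZ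
  exact ⟨X', π, hprop, hbir, hfi⟩

/-- **★ THE DIM ≤ d SLICE OF THE CRUX ⟸ {CP 1.1, R–G 081R, CP 4.4, Česnavičius 5.3 (as typed)} ∧ RUNGS `4 … d − 1` ∧ F-HALF `4 … d`.** The ∀-text of
`Theses.FrobeniusLadder.FInjectiveMacaulayfication` VERBATIM with the single extra binder `topologicalKrullDim X ≤ d`; the resolution rung
`ClosedPointLocalResolutionAdmTr p e r` enters ONLY at the levels `4 ≤ e ≤ d − 1`, `r ≥ 1` (closed points over `k(X₁,…,X_r)`, imperfect) and the F-half ONLY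
at the levels `4 ≤ n ≤ d` — the per-dimension price tag.
[OURS · conditional-result] [cite: CossartPiltant2019, Thm. 1.1; Prop. 4.4] [cite: Temkin2008, Prop. 2.3.4] [cite: Cesnavicius2021, Thm. 5.3] -/
theorem fInjectiveMacaulayfication_dimLe_of_cm_of_rungs_of_F (d : ℕ)
    (hG : CossartPiltant2019General.{0}) (h081R : Stacks081R.{0}) (hP : CossartPiltant2019Principalization.{0})
    (hCM : ∀ (p : ℕ), p.Prime → ∀ {k : Type} [Field k] [CharP k p] {X : Scheme.{0}} (f : X ⟶ Spec (.of k))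
      [LocallyOfFiniteType f] [IsIntegral X] (x : X), ringKrullDim (X.presheaf.stalk x) ≠ 0 →
      ∀ (S' : Scheme.{0}) (g : S' ⟶ Spec (X.presheaf.stalk x)) (I : (Spec (X.presheaf.stalk x)).IdealSheafData),
        I ≠ ⊥ → IsBlowup g I → (∀ s : S', g.base s ≠ closedPoint (X.presheaf.stalk x) → s ∈ Scheme.regularLocus S') →
        ∃ 𝓚 : S'.IdealSheafData, 𝓚 ≠ ⊥ ∧ (∀ s ∈ (𝓚.support : Set S'), g.base s = closedPoint (X.presheaf.stalk x)) ∧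
          ∀ (S'' : Scheme.{0}) (π : S'' ⟶ S'), IsBlowup π 𝓚 → ∀ s : S'', IsDomain (S''.presheaf.stalk s) ∧ CMCl (S''.presheaf.stalk s))
    (hR : ∀ p e r : ℕ, p.Prime → 4 ≤ e → e + 1 ≤ d → 1 ≤ r → ClosedPointLocalResolutionAdmTr p e r)
    (hF : ∀ n : ℕ, 4 ≤ n → n ≤ d → ∀ (p : ℕ), p.Prime → ∀ (k : Type) [Field k] [CharP k p]
    (X : Scheme.{0}) (f : X ⟶ Spec (.of k)),
      IsSeparated f → LocallyOfFiniteType f → QuasiCompact f → IsIntegral X →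
      ∀ x : X, IsClosed ({x} : Set X) → x ∉ Scheme.regularLocus X → ringKrullDim (X.presheaf.stalk x) = n →
      ∀ (S' : Scheme.{0}) (g : S' ⟶ Spec (X.presheaf.stalk x)) (I : (Spec (X.presheaf.stalk x)).IdealSheafData),
        I ≠ ⊥ → (I.support : Set (Spec (X.presheaf.stalk x))) ⊆ (Scheme.regularLocus (Spec (X.presheaf.stalk x)))ᶜ → IsBlowup g I →
        (∀ s : S', g.base s ≠ closedPoint (X.presheaf.stalk x) → s ∈ Scheme.regularLocus S') →
        (∀ s : S', CMCl (S'.presheaf.stalk s)) →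
        ∃ 𝓚 : S'.IdealSheafData, 𝓚 ≠ ⊥ ∧ (∀ s ∈ (𝓚.support : Set S'), g.base s = closedPoint (X.presheaf.stalk x)) ∧
          ∀ (S'' : Scheme.{0}) (π : S'' ⟶ S'), IsBlowup π 𝓚 →
            ∀ s : S'', FullCl p (S''.presheaf.stalk s)) :
    ∀ p : ℕ, p.Prime → ∀ (k : Type) [Field k] [CharP k p] (X : Scheme.{0}) (f : X ⟶ Spec (.of k)),
      IsSeparated f → LocallyOfFiniteType f → QuasiCompact f → IsReduced X → topologicalKrullDim X ≤ d →
      ∃ (X' : Scheme.{0}) (π : X' ⟶ X), IsProper π ∧ IsBirational π ∧ ∀ x : X',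
        IsDomain (X'.presheaf.stalk x) ∧ ∀ d : ℕ, ringKrullDim (X'.presheaf.stalk x) = d →
          ∀ s : Fin d → X'.presheaf.stalk x, (Ideal.span (Set.range s)).radical.IsMaximal →
            RingTheory.Sequence.IsWeaklyRegular (X'.presheaf.stalk x) (List.ofFn s) ∧
            ∀ y : X'.presheaf.stalk x, (∃ e : ℕ, y ^ p ^ e ∈ Ideal.span
              ((fun z : X'.presheaf.stalk x => z ^ p ^ e) ''
                (Ideal.span (Set.range s) : Set (X'.presheaf.stalk x)))) →
              y ∈ Ideal.span (Set.range s) := by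
  intro p hp k _ _ X f hsep hft hqc hred hXd
  haveI : Fact p.Prime := ⟨hp⟩
  haveI := hsep
  haveI := hft
  haveI := hqc
  haveI := hred
  exact exists_fiModel_dimLe_of_cm_of_rungs_of_F d hG h081R hP hCM p (fun e r he hed hr => hR p e r hp he hed hr)
    (fun n hn hnd => hF n hn hnd p hp) k X f hXd

/-- **The same with the chain's registered F-half IN FULL** (`LocalFullificationFibreAdmGe4Split.LocalFInjectivizationFibreAdmGe4`, all levels) — for readers who
hold the door's F-stub: on schemes of dimension `≤ d` the resolution-side input of door v36.2 is exactly the closed-point rungs `4 … d − 1`.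
[OURS · conditional-result] [cite: CossartPiltant2019, Thm. 1.1; Prop. 4.4] [cite: Temkin2008, Prop. 2.3.4] [cite: Cesnavicius2021, Thm. 5.3] -/
theorem fInjectiveMacaulayfication_dimLe_of_cm_of_rungs_of_LFadmF (d : ℕ)
    (hG : CossartPiltant2019General.{0}) (h081R : Stacks081R.{0}) (hP : CossartPiltant2019Principalization.{0})
    (hCM : ∀ (p : ℕ), p.Prime → ∀ {k : Type} [Field k] [CharP k p] {X : Scheme.{0}} (f : X ⟶ Spec (.of k))
      [LocallyOfFiniteType f] [IsIntegral X] (x : X), ringKrullDim (X.presheaf.stalk x) ≠ 0 →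
      ∀ (S' : Scheme.{0}) (g : S' ⟶ Spec (X.presheaf.stalk x)) (I : (Spec (X.presheaf.stalk x)).IdealSheafData),
        I ≠ ⊥ → IsBlowup g I → (∀ s : S', g.base s ≠ closedPoint (X.presheaf.stalk x) → s ∈ Scheme.regularLocus S') →
        ∃ 𝓚 : S'.IdealSheafData, 𝓚 ≠ ⊥ ∧ (∀ s ∈ (𝓚.support : Set S'), g.base s = closedPoint (X.presheaf.stalk x)) ∧
          ∀ (S'' : Scheme.{0}) (π : S'' ⟶ S'), IsBlowup π 𝓚 → ∀ s : S'', IsDomain (S''.presheaf.stalk s) ∧ CMCl (S''.presheaf.stalk s))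
    (hR : ∀ p e r : ℕ, p.Prime → 4 ≤ e → e + 1 ≤ d → 1 ≤ r → ClosedPointLocalResolutionAdmTr p e r)
    (hLF : LocalFullificationFibreAdmGe4Split.LocalFInjectivizationFibreAdmGe4) :
    ∀ p : ℕ, p.Prime → ∀ (k : Type) [Field k] [CharP k p] (X : Scheme.{0}) (f : X ⟶ Spec (.of k)),
      IsSeparated f → LocallyOfFiniteType f → QuasiCompact f → IsReduced X → topologicalKrullDim X ≤ d →
      ∃ (X' : Scheme.{0}) (π : X' ⟶ X), IsProper π ∧ IsBirational π ∧ ∀ x : X',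
        IsDomain (X'.presheaf.stalk x) ∧ ∀ d : ℕ, ringKrullDim (X'.presheaf.stalk x) = d →
          ∀ s : Fin d → X'.presheaf.stalk x, (Ideal.span (Set.range s)).radical.IsMaximal →
            RingTheory.Sequence.IsWeaklyRegular (X'.presheaf.stalk x) (List.ofFn s) ∧
            ∀ y : X'.presheaf.stalk x, (∃ e : ℕ, y ^ p ^ e ∈ Ideal.span
              ((fun z : X'.presheaf.stalk x => z ^ p ^ e) ''
                (Ideal.span (Set.range s) : Set (X'.presheaf.stalk x)))) →
              y ∈ Ideal.span (Set.range s) :=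
  fInjectiveMacaulayfication_dimLe_of_cm_of_rungs_of_F d hG h081R hP hCM hR fun n hn _ => hLF n hn

end Summit.ResolutionOfSingularities.ResolutionOfSingularities.Theorems.FInjectiveMacaulayfication.DimSliceCM

end
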